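import Summits.ResolutionOfSingularities.ResolutionOfSingularities.Theorems.FrobeniusClosingPatchingRelPerfectDepthTaylorInitialCharts
import Summits.ResolutionOfSingularities.ResolutionOfSingularities.Theorems.FrobeniusClosingPatchingRelPerfectDepthParamLiftFlat
import Literature.AlgebraicGeometry.Resolution.ProjHomogeneousIdealSheaf
import Literature.AlgebraicGeometry.Resolution.ProjectiveSpaceExcellent
import Literature.AlgebraicGeometry.Resolution.MonomialOrderReductionUnit
import HarnessLib

/-!
# `PatchingRelPerfect` (stmt-ResolutionOfSingularities-16161), chain W5.2 — F7(β) (β-AX) T0: PARAM-LIFT of the line-bundle retraction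
# `R₀ : X₁ = Bl_𝔪 Spec S ⟶ ℙᵐ_{κ₀}` OFF the exceptional divisor (the chart plumbing over the direction-map theorem)

[OURS · L1 W5.2 · res-D-pv-055 (hand for T0; plan-1 RULINGS G11-18/27/31, spec v4.2 §7 A3)] The last input `hoff` of
`isParamLiftAt_top_retraction₀_of_offE` (p553935): at a point `y₀ ∉ E` of `X₁`, the retraction `R₀` has pv-034's parameter-lift
property. By pv-034's kernel `isParamLiftAt_of_flat_of_isRegularLocalRing_fiber` (p551652) it suffices that the stalk map
`f = R₀^♯_{y₀} : 𝒪_{ℙ, R₀ y₀} → 𝒪_{X₁, y₀}` is FLAT with REGULAR closed fibre. We reduce this to the commutative-algebra theorem of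
res-D-pv-046 (`directionMap_flat_and_isRegularLocalRing_fiber`, `…DepthDirectionMapRegular`, p553231/p553979; taken here as the
hypothesis `hDM` in its localisation-model form) by identifying the rings: with `y₀ ∈ D₊(y_j t)` (`y_j ∉ π(y₀)`, which exists off `E`),
* `𝒪_{X₁,y₀}` is an `S_𝔭`-model, `𝔭 = π(y₀)`, through `π^♯` (the blow-up is a local isomorphism off `E`,
  `IsBlowup.isIso_stalkMap_of_not_mem_support`) — `isLocalizationAtPrime_stalk_of_not_mem`;
* `𝒪_{ℙ,c}`, `c = R₀ y₀ ∈ D₊(T_j)`, is a localisation of `Γ(ℙ, D₊(T_j)) ≅ (κ₀[T]_{T_j})₀ ≅ κ₀[u]` (Mathlib `IsAffineOpen.isLocalization_stalk`,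
  `Proj.basicOpenIsoAway`, tree `ProjectiveSpace.chartAlgEquiv`);
* the composite `ψ : κ₀[u] → 𝒪_{X₁,y₀}` satisfies `ψ(u_i) · y_j = y_{j.succAbove i}` and `ψ(c) = σ c`: on sections `R₀^*` is the chart
  map `ρ_j` (`app_retraction₀_awayToSection`, Mathlib `Proj.awayToSection_comp_appLE`), `π^♯ ∘ (S → 𝒪)` is `awayToSection ∘ (s ↦ s/1)`
  (`stalkMap_π_toStalk`), and in the chart ring `ρ_j(T_{i'}/T_j) · y_j/1 = y_{i'}/1` (`DepthOne.reesAwayBase_pow_mul_awayMap`);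
* flatness and the regular fibre descend from `ψ = f ∘ (κ₀[u] → 𝒪_{ℙ,c})` to `f` (`flat_and_isRegularLocalRing_fiber_of_comp`:
  `Module.flat_iff_of_isLocalization`, `𝔪_{𝒪_{ℙ,c}} = 𝔮 𝒪_{ℙ,c}`).

Honest framing: OURS (AI-written, weaker than expert review); plumbing over tree theorems; nothing here is a statement of the
manuscript under review.

## Sources
* H. Matsumura, *Commutative Ring Theory* (1987), Thm. 23.1, Thm. 23.7. [Matsumura1987]
* R. Hartshorne, *Algebraic Geometry* (1977), II Prop. 5.11, Thm. 8.24. [Hartshorne1977]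
* The Stacks Project, Tag 0804, Tag 02OS. [StacksProject]
-/

set_option linter.dupNamespace false -- mandated namespace of this single-conjunct summit

noncomputable section

open CategoryTheory CategoryTheory.Limits AlgebraicGeometry Literature.AlgebraicGeometry.Resolution
open IsLocalRing TopologicalSpace HomogeneousLocalization Scheme.IdealSheafData
open Literature.AlgebraicGeometry.Motives Literature.AlgebraicGeometry.Motives.ProjBaseChangeRing

namespace Summit.ResolutionOfSingularities.ResolutionOfSingularities.Theorems.DepthMultiHost

universe u

/-! ## §1 Algebra: flatness and the regular fibre descend from the composite with a localisation -/

/-- **Flatness and the regular closed fibre descend from the composite with a localisation.** Let `A` be the localisation of `R`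
at a prime `P`, `f : A → B` a local homomorphism of local rings, `ψ = f ∘ (R → A)`. If `ψ` is flat and `B ⧸ ψ(ψ⁻¹ 𝔪_B) B` is a regular
local ring, then `f` is flat (`Module.flat_iff_of_isLocalization`) and `B ⧸ 𝔪_A B` is regular (`𝔪_A = P A`, `ψ⁻¹ 𝔪_B = P`).
[cite: Matsumura1987, Thm. 23.7] -/
theorem flat_and_isRegularLocalRing_fiber_of_comp {R A B : Type u} [CommRing R] [CommRing A] [CommRing B]
    [Algebra R A] [IsLocalRing A] [IsLocalRing B] (P : Ideal R) [P.IsPrime] [IsLocalization.AtPrime A P]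
    (f : A →+* B) [IsLocalHom f] (hflat : (f.comp (algebraMap R A)).Flat)
    (hfib : IsRegularLocalRing
      (B ⧸ Ideal.map (f.comp (algebraMap R A)) ((maximalIdeal B).comap (f.comp (algebraMap R A))))) :
    f.Flat ∧ IsRegularLocalRing (B ⧸ (maximalIdeal A).map f) := by
  constructor
  · letI : Algebra A B := f.toAlgebra
    letI : Algebra R B := (f.comp (algebraMap R A)).toAlgebra
    haveI : IsScalarTower R A B := IsScalarTower.of_algebraMap_eq (fun r => rfl)
    haveI : Module.Flat R B := hflat
    exact (Module.flat_iff_of_isLocalization (S := A) (p := P.primeCompl) (M := B)).mpr inferInstance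
  · have hid : (maximalIdeal A).map f =
        Ideal.map (f.comp (algebraMap R A)) ((maximalIdeal B).comap (f.comp (algebraMap R A))) := by
      rw [← Ideal.comap_comap, IsLocalRing.maximalIdeal_comap, ← Ideal.under_def,
        IsLocalization.AtPrime.under_maximalIdeal A P, ← Ideal.map_map, IsLocalization.AtPrime.map_eq_maximalIdeal P A]
    rw [hid]
    exact hfib

/-! ## §2 The chart identities on `X₁ = Bl_𝔪 Spec S` -/

section Setup

variable {S : Type u} [CommRing S] {m : ℕ} (y : Fin (m + 1) → S) (κ₀ : Type u) [Field κ₀] [Algebra κ₀ S]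

local notation3 "ℛ" => reesGrading (Ideal.span (Set.range y))
local notation3 "X₁" => affineBlowup (Ideal.span (Set.range y))
local notation3 "𝒜κ" => MvPolynomial.homogeneousSubmodule (Fin (m + 1)) κ₀
/-- the chart element `y_i t ∈ S[𝔪t]` (as in `…DepthGradedCharts`) -/
local notation3 "sElt" => fun (i : Fin (m + 1)) =>
  (reesPresentation y) ((mapGraded κ₀ S (Fin (m + 1))) (MvPolynomial.X i))
/-- `r₀` written out (as in `…DepthGradedRetraction`). -/
local notation3 "R₀" => (Proj.map (reesPresentation y) (irrelevant_le_map_reesPresentation y) ≫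
  Proj.map (mapGraded κ₀ S (Fin (m + 1))) (irrelevant_le_map κ₀ S (Fin (m + 1))) :
    affineBlowup (Ideal.span (Set.range y)) ⟶ ProjSpace.P m κ₀)
/-- the ring map of the chart retraction `ρ_j : (κ₀[T]_{T_j})₀ → (S[𝔪t]_{y_j t})₀` -/
local notation3 "ρ" => fun (j : Fin (m + 1)) =>
  (Away.map (reesPresentation y) ((mapGraded κ₀ S (Fin (m + 1))) (MvPolynomial.X j))).comp
    (Away.map (mapGraded κ₀ S (Fin (m + 1))) (MvPolynomial.X j))
/-- the chart `α_j : Spec (S[𝔪t]_{y_j t})₀ ↪ X₁` -/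
local notation3 "α" => fun (j : Fin (m + 1)) => Proj.awayι ℛ (sElt j) (DepthOne.sElt_mem y κ₀ j) one_pos

/-- **`R₀^*` on sections of `D₊(T_j)` is the chart map `ρ_j`** (through `awayToSection`; Mathlib `Proj.awayToSection_comp_appLE`
twice). [cite: Hartshorne1977, II Prop. 5.11 (b)] -/
theorem app_retraction₀_awayToSection (j : Fin (m + 1))
    (b : letI : GradedRing (MvPolynomial.homogeneousSubmodule (Fin (m + 1)) κ₀) := MvPolynomial.gradedAlgebra
      Away 𝒜κ (MvPolynomial.X j)) :
    letI : GradedRing (MvPolynomial.homogeneousSubmodule (Fin (m + 1)) S) := MvPolynomial.gradedAlgebra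
    letI : GradedRing (MvPolynomial.homogeneousSubmodule (Fin (m + 1)) κ₀) := MvPolynomial.gradedAlgebra
    ((R₀).app (Proj.basicOpen 𝒜κ (MvPolynomial.X j))).hom
        ((Proj.awayToSection 𝒜κ (MvPolynomial.X j)).hom b) =
      (Proj.awayToSection ℛ (sElt j)).hom ((ρ j) b) := by
  letI : GradedAlgebra (MvPolynomial.homogeneousSubmodule (Fin (m + 1)) S) := MvPolynomial.gradedAlgebra
  letI : GradedAlgebra (MvPolynomial.homogeneousSubmodule (Fin (m + 1)) κ₀) := MvPolynomial.gradedAlgebra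
  show ((Proj.map (reesPresentation y) (irrelevant_le_map_reesPresentation y)).app _).hom
      (((Proj.map (mapGraded κ₀ S (Fin (m + 1))) (irrelevant_le_map κ₀ S (Fin (m + 1)))).app
        (Proj.basicOpen 𝒜κ (MvPolynomial.X j))).hom ((Proj.awayToSection 𝒜κ (MvPolynomial.X j)).hom b)) = _
  rw [projMap_app_awayToSection (mapGraded κ₀ S (Fin (m + 1))) (irrelevant_le_map κ₀ S (Fin (m + 1)))
      (ProjectiveSpace.X_mem (R := κ₀) j) b]
  exact projMap_app_awayToSection (reesPresentation y) (irrelevant_le_map_reesPresentation y)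
      ((mapGraded κ₀ S (Fin (m + 1))).map_mem (ProjectiveSpace.X_mem (R := κ₀) j)) _

set_option maxHeartbeats 1600000 in
/-- **The structure map on stalks through the chart sections**: for `y₀ ∈ D₊(y_j t)` and `s ∈ S`, `π^♯_{y₀}(s) = germ_{y₀}(s/1)`
with `s/1 = awayToSection (reesAwayBase s) ∈ Γ(X₁, D₊(y_j t))` (pull back along the chart `α_j`, where both sides are `s/1` in
`Γ(Spec (S[𝔪t]_{y_j t})₀, ⊤)`: `α_j ≫ π = Spec (s ↦ s/1)`, `DepthOne.appLE_awayι_awayToSection`). [cite: StacksProject, Tag 0804] -/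
theorem stalkMap_π_toStalk (j : Fin (m + 1)) (y₀ : X₁)
    (hy₀ : letI : GradedRing (MvPolynomial.homogeneousSubmodule (Fin (m + 1)) S) := MvPolynomial.gradedAlgebra
      letI : GradedRing (MvPolynomial.homogeneousSubmodule (Fin (m + 1)) κ₀) := MvPolynomial.gradedAlgebra
      y₀ ∈ Proj.basicOpen ℛ (sElt j)) (s : S) :
    letI : GradedRing (MvPolynomial.homogeneousSubmodule (Fin (m + 1)) S) := MvPolynomial.gradedAlgebra
    letI : GradedRing (MvPolynomial.homogeneousSubmodule (Fin (m + 1)) κ₀) := MvPolynomial.gradedAlgebra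
    ((affineBlowup.π (Ideal.span (Set.range y))).stalkMap y₀).hom
        ((StructureSheaf.toStalk S ((affineBlowup.π (Ideal.span (Set.range y))).base y₀)).hom s) =
      ((affineBlowup (Ideal.span (Set.range y))).presheaf.germ (Proj.basicOpen ℛ (sElt j)) y₀ hy₀).hom
        ((Proj.awayToSection ℛ (sElt j)).hom (reesAwayBase y (sElt j) s)) := by
  letI : GradedAlgebra (MvPolynomial.homogeneousSubmodule (Fin (m + 1)) S) := MvPolynomial.gradedAlgebra
  letI : GradedAlgebra (MvPolynomial.homogeneousSubmodule (Fin (m + 1)) κ₀) := MvPolynomial.gradedAlgebra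
  -- the section identity on `D₊(y_j t)`: `π^* s |_{D₊} = awayToSection (s/1)`
  have hsec : ((affineBlowup.π (Ideal.span (Set.range y))).appLE ⊤ (Proj.basicOpen ℛ (sElt j)) le_top).hom
      ((Scheme.ΓSpecIso (.of S)).inv.hom s) =
      (Proj.awayToSection ℛ (sElt j)).hom (reesAwayBase y (sElt j) s) := by
    have hle : (⊤ : (Spec (.of (Away ℛ (sElt j)))).Opens) ≤ (α j) ⁻¹ᵁ Proj.basicOpen ℛ (sElt j) :=
      DepthOne.top_le_preimage_of_opensRange_eq _
        (Proj.opensRange_awayι ℛ (sElt j) (DepthOne.sElt_mem y κ₀ j) one_pos)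
    -- pulling back along the chart `α_j` is injective on sections of `D₊(y_j t)`
    have hV : (α j) ⁻¹ᵁ Proj.basicOpen ℛ (sElt j) = ⊤ := by
      rw [← Proj.opensRange_awayι ℛ (sElt j) (DepthOne.sElt_mem y κ₀ j) one_pos, Scheme.Hom.preimage_opensRange]
    have hiso : IsIso ((α j).appLE (Proj.basicOpen ℛ (sElt j)) ⊤ hle) := by
      rw [Scheme.Hom.appLE]
      have h1 : IsIso ((α j).app (Proj.basicOpen ℛ (sElt j))) :=
        Scheme.Hom.isIso_app _ _ (by rw [Proj.opensRange_awayι])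
      have h2 : IsIso ((Spec (.of (Away ℛ (sElt j)))).presheaf.map (homOfLE hle).op) := by
        have : homOfLE hle = eqToHom hV.symm := Subsingleton.elim _ _
        rw [this, eqToHom_op, eqToHom_map]; infer_instance
      exact IsIso.comp_isIso
    have hinj : Function.Injective ((α j).appLE (Proj.basicOpen ℛ (sElt j)) ⊤ hle) :=
      (ConcreteCategory.bijective_of_isIso ((α j).appLE (Proj.basicOpen ℛ (sElt j)) ⊤ hle)).1
    apply hinj
    rw [DepthOne.appLE_awayι_awayToSection, ← CommRingCat.comp_apply, Scheme.Hom.appLE_comp_appLE]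
    erw [Scheme.Hom.appLE_eq_app]
    -- `(α_j ≫ π)^* s = (s/1)` through `Γ(Spec, ⊤) ≅ (S[𝔪t]_{y_j t})₀`
    have hc : (α j ≫ affineBlowup.π (Ideal.span (Set.range y))).appTop =
        (Spec.map (CommRingCat.ofHom (reesAwayBase y (sElt j)))).appTop := by
      rw [awayι_comp_π y (sElt j) (DepthOne.sElt_mem y κ₀ j) one_pos]
    have hnat := Scheme.ΓSpecIso_inv_naturality (CommRingCat.ofHom (reesAwayBase y (sElt j)))
    have hnat' := congrArg (fun φ => φ.hom s) hnat
    simp only [CommRingCat.hom_comp, RingHom.comp_apply, CommRingCat.hom_ofHom] at hnat'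
    show ((α j ≫ affineBlowup.π (Ideal.span (Set.range y))).appTop).hom ((Scheme.ΓSpecIso (.of S)).inv.hom s) = _
    rw [hc]
    exact hnat'.symm
  -- germs: `toStalk s = germ_⊤ (s)`, `π.stalkMap (germ t) = germ (π^* t)`, restriction to `D₊`
  have htop : (StructureSheaf.toStalk S ((affineBlowup.π (Ideal.span (Set.range y))).base y₀)).hom s =
      ((Spec (.of S)).presheaf.germ ⊤ ((affineBlowup.π (Ideal.span (Set.range y))).base y₀) trivial).hom
        ((Scheme.ΓSpecIso (.of S)).inv.hom s) := by
    have h := StructureSheaf.algebraMap_germ (R := S) ⊤ ((affineBlowup.π (Ideal.span (Set.range y))).base y₀) trivial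
    have h' := congrArg (fun φ => φ.hom s) h
    simp only [CommRingCat.hom_comp, RingHom.comp_apply, CommRingCat.hom_ofHom] at h'
    exact h'.symm
  rw [htop, ← hsec]
  simp only [Scheme.Hom.germ_stalkMap_apply, Scheme.Hom.appLE, CommRingCat.hom_comp, RingHom.coe_comp,
    Function.comp_apply, TopCat.Presheaf.germ_res_apply]

omit [Algebra κ₀ S] in
/-- **Off `E` the stalk `𝒪_{X₁,y₀}` is the localisation of `S` at `π(y₀)`** through `π^♯` (the blowing up is a local
isomorphism off the exceptional divisor, `IsBlowup.isIso_stalkMap_of_not_mem_support`, and `𝒪_{Spec S, π y₀} = S_{π y₀}`).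
[cite: StacksProject, Tag 02OS] -/
theorem isLocalizationAtPrime_stalk_of_not_mem (y₀ : X₁)
    (hy₀ : y₀ ∉ (((affineBlowup.idealSheaf (Ideal.span (Set.range y))).comap
      (affineBlowup.π (Ideal.span (Set.range y)))).support : Set X₁)) :
    letI : Algebra S ((affineBlowup (Ideal.span (Set.range y))).presheaf.stalk y₀) :=
      (((affineBlowup.π (Ideal.span (Set.range y))).stalkMap y₀).hom.comp
        (StructureSheaf.toStalk S ((affineBlowup.π (Ideal.span (Set.range y))).base y₀)).hom).toAlgebra
    IsLocalization.AtPrime ((affineBlowup (Ideal.span (Set.range y))).presheaf.stalk y₀)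
      ((affineBlowup.π (Ideal.span (Set.range y))).base y₀).asIdeal := by
  letI : Algebra S ((affineBlowup (Ideal.span (Set.range y))).presheaf.stalk y₀) :=
    (((affineBlowup.π (Ideal.span (Set.range y))).stalkMap y₀).hom.comp
      (StructureSheaf.toStalk S ((affineBlowup.π (Ideal.span (Set.range y))).base y₀)).hom).toAlgebra
  haveI : IsIso ((affineBlowup.π (Ideal.span (Set.range y))).stalkMap y₀) :=
    IsBlowup.isIso_stalkMap_of_not_mem_support (affineBlowup.isBlowup (Ideal.span (Set.range y)))
      (by rwa [Scheme.IdealSheafData.support_comap] at hy₀)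
  letI : Algebra S ((Spec (.of S)).presheaf.stalk ((affineBlowup.π (Ideal.span (Set.range y))).base y₀)) :=
    StructureSheaf.stalkAlgebra (R := S) _
  haveI : IsLocalization.AtPrime ((Spec (.of S)).presheaf.stalk ((affineBlowup.π (Ideal.span (Set.range y))).base y₀))
      ((affineBlowup.π (Ideal.span (Set.range y))).base y₀).asIdeal :=
    StructureSheaf.IsLocalization.to_stalk S _
  let e : (Spec (.of S)).presheaf.stalk ((affineBlowup.π (Ideal.span (Set.range y))).base y₀) ≃ₐ[S]
      (affineBlowup (Ideal.span (Set.range y))).presheaf.stalk y₀ :=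
    AlgEquiv.ofRingEquiv (f := (asIso ((affineBlowup.π (Ideal.span (Set.range y))).stalkMap y₀)).commRingCatIsoToRingEquiv)
      (fun s => rfl)
  exact IsLocalization.isLocalization_of_algEquiv _ e

set_option maxHeartbeats 1600000 in
/-- **PARAM-LIFT of `R₀` OFF `E`.** Let `S` be regular local with residue field `κ₀ ≅ S/𝔪` through `κ₀ → S`, `y` generators of `𝔪`,
and assume the DIRECTION-MAP THEOREM `hDM` (res-D-pv-046's `directionMap_flat_and_isRegularLocalRing_fiber` in localisation-model form:
for a prime `𝔭 ∌ y_j` and any `S_𝔭`-model `B`, every `ψ : κ₀[u] → B` with `ψ(c) = c` and `ψ(u_i) · y_j = y_{j.succAbove i}` is flat with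
regular closed fibre). Then at every point `y₀ ∉ E` of `X₁ = Bl_𝔪 Spec S` the retraction `R₀ : X₁ → ℙᵐ_{κ₀}` has pv-034's
parameter-lift property: chart `D₊(y_j t) ∋ y₀` with `y_j ∉ π(y₀)` (`affineBlowup.reesT_notMem`), rings identified as in the module
docstring, `hDM` applied to `ψ = R₀^♯_{y₀} ∘ (κ₀[u] ≅ Γ(ℙ, D₊ T_j) → 𝒪_{ℙ, R₀ y₀})`, the chart isomorphism stripped, the localisation
descended (`flat_and_isRegularLocalRing_fiber_of_comp`), and the kernel `isParamLiftAt_of_flat_of_isRegularLocalRing_fiber` applied.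
[cite: Matsumura1987, Thm. 23.7] [cite: Hartshorne1977, II Thm. 8.24 (b)] -/
theorem isParamLiftAt_retraction₀_of_not_mem_support [IsRegularLocalRing S]
    (hDM : ∀ (𝔭 : Ideal S) [𝔭.IsPrime] (j : Fin (m + 1)), y j ∉ 𝔭 →
      ∀ (B : Type u) [CommRing B] [Algebra S B] [IsLocalRing B] [IsLocalization.AtPrime B 𝔭]
        (ψ : MvPolynomial (Fin m) κ₀ →+* B),
        (∀ c, ψ (MvPolynomial.C c) = algebraMap S B (algebraMap κ₀ S c)) →
        (∀ i, ψ (MvPolynomial.X i) * algebraMap S B (y j) = algebraMap S B (y (j.succAbove i))) →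
        ψ.Flat ∧ IsRegularLocalRing (B ⧸ Ideal.map ψ ((IsLocalRing.maximalIdeal B).comap ψ)))
    (y₀ : X₁)
    (hy₀ : y₀ ∉ (((affineBlowup.idealSheaf (Ideal.span (Set.range y))).comap
      (affineBlowup.π (Ideal.span (Set.range y)))).support : Set X₁)) :
    letI : GradedRing (MvPolynomial.homogeneousSubmodule (Fin (m + 1)) S) := MvPolynomial.gradedAlgebra
    letI : GradedRing (MvPolynomial.homogeneousSubmodule (Fin (m + 1)) κ₀) := MvPolynomial.gradedAlgebra
    IsParamLiftAt R₀ y₀ := by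
  letI : GradedAlgebra (MvPolynomial.homogeneousSubmodule (Fin (m + 1)) S) := MvPolynomial.gradedAlgebra
  letI : GradedAlgebra (MvPolynomial.homogeneousSubmodule (Fin (m + 1)) κ₀) := MvPolynomial.gradedAlgebra
  -- a chart `D₊(y_j t) ∋ y₀` with `y_j ∉ π(y₀)`
  have hπ : ¬ Ideal.span (Set.range y) ≤ ((affineBlowup.π (Ideal.span (Set.range y))).base y₀).asIdeal := by
    intro hle
    apply hy₀
    rw [Scheme.IdealSheafData.support_comap, Closeds.coe_preimage, Set.mem_preimage, affineBlowup.support_idealSheaf]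
    exact (PrimeSpectrum.mem_zeroLocus _ _).mpr hle
  obtain ⟨j, hj⟩ : ∃ j, y j ∉ ((affineBlowup.π (Ideal.span (Set.range y))).base y₀).asIdeal := by
    by_contra h
    push Not at h
    exact hπ (Ideal.span_le.mpr (by rintro _ ⟨j, rfl⟩; exact h j))
  have hy₀j : y₀ ∈ Proj.basicOpen ℛ (sElt j) := by
    rw [DepthOne.sElt_eq_reesT y κ₀ j, Proj.mem_basicOpen]
    exact affineBlowup.reesT_notMem _ _ y₀ (by rwa [← affineBlowup.mem_π_apply_iff])
  have hc : (R₀).base y₀ ∈ Proj.basicOpen 𝒜κ (MvPolynomial.X j) := by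
    have h := hy₀j
    rw [DepthOne.basicOpen_sElt_eq_preimage y κ₀ j] at h
    exact h
  letI : Algebra κ₀ (Away 𝒜κ (MvPolynomial.X j)) :=
    Literature.AlgebraicGeometry.Motives.ProjBaseChange.algebraBase _ _
  -- the chart identities `ψ(u_i) · y_j = y_{j.succAbove i}`, `ψ(c) = c` in `(S[𝔪t]_{y_j t})₀`
  have ρ_chartGen_mul : ∀ i : Fin m,
      (ρ j) ((ProjectiveSpace.chartAlgEquiv κ₀ j).symm (MvPolynomial.X i)) * reesAwayBase y (sElt j) (y j) =
        reesAwayBase y (sElt j) (y (j.succAbove i)) := by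
    intro i
    have h := DepthOne.reesAwayBase_pow_mul_awayMap y κ₀ j (e := 1) (MvPolynomial.X (j.succAbove i))
      (ProjectiveSpace.X_mem (R := κ₀) (j.succAbove i))
    simp only [MvPolynomial.aeval_X] at h
    have hgen : (ProjectiveSpace.chartAlgEquiv κ₀ j).symm (MvPolynomial.X i) =
        Away.isLocalizationElem (ProjectiveSpace.X_mem (R := κ₀) j) (ProjectiveSpace.X_mem (R := κ₀) (j.succAbove i)) := by
      rw [ProjectiveSpace.chartAlgEquiv_symm_X]
      apply val_injective
      rw [ProjectiveSpace.val_chartGen]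
      simp only [Away.isLocalizationElem, Away.val_mk, pow_one]
    rw [hgen]
    apply HomogeneousLocalization.val_injective
    have h' := congrArg HomogeneousLocalization.val h
    simp only [HomogeneousLocalization.val_mul, HomogeneousLocalization.val_pow, pow_one] at h'
    rw [HomogeneousLocalization.val_mul, mul_comm]
    exact h'
  have ρ_C : ∀ c : κ₀, (ρ j) ((ProjectiveSpace.chartAlgEquiv κ₀ j).symm (MvPolynomial.C c)) =
      reesAwayBase y (sElt j) (algebraMap κ₀ S c) := by
    intro c
    have h := DepthOne.reesAwayBase_pow_mul_awayMap y κ₀ j (e := 0) (MvPolynomial.C c) (MvPolynomial.isHomogeneous_C _ c)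
    simp only [MvPolynomial.aeval_C] at h
    have hgen : (ProjectiveSpace.chartAlgEquiv κ₀ j).symm (MvPolynomial.C c) =
        Away.isLocalizationElem (ProjectiveSpace.X_mem (R := κ₀) j) (MvPolynomial.isHomogeneous_C _ c) := by
      rw [← MvPolynomial.algebraMap_eq, AlgEquiv.commutes]
      apply val_injective
      rw [Literature.AlgebraicGeometry.Motives.ProjBaseChange.val_algebraMap]
      simp only [Away.isLocalizationElem, Away.val_mk, pow_zero, pow_one]
      change _ = Localization.mk (MvPolynomial.C c) 1
      rw [Localization.mk_one_eq_algebraMap, ← Localization.mk_algebraMap, MvPolynomial.algebraMap_eq]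
      exact (Localization.mk_one_eq_algebraMap _).symm
    rw [hgen]
    apply HomogeneousLocalization.val_injective
    have h' := congrArg HomogeneousLocalization.val h
    simp only [HomogeneousLocalization.val_mul, HomogeneousLocalization.val_pow, pow_zero, one_mul] at h'
    exact h'
  -- `B = 𝒪_{X₁,y₀}`, an `S_𝔭`-model through `π`
  haveI : IsNoetherian (affineBlowup (Ideal.span (Set.range y))) := DepthOne.isNoetherian_blowup y
  haveI : IsNoetherian (ProjSpace.P m κ₀) := (ProjectiveSpace.projSpace_standing m κ₀).2.1
  letI : Algebra S ((affineBlowup (Ideal.span (Set.range y))).presheaf.stalk y₀) :=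
    (((affineBlowup.π (Ideal.span (Set.range y))).stalkMap y₀).hom.comp
      (StructureSheaf.toStalk S ((affineBlowup.π (Ideal.span (Set.range y))).base y₀)).hom).toAlgebra
  haveI := isLocalizationAtPrime_stalk_of_not_mem y y₀ hy₀
  -- `A = 𝒪_{ℙ,c}`, a localisation of `Γ(ℙ, D₊(T_j)) ≅ κ₀[u]`
  have hU : IsAffineOpen (Proj.basicOpen 𝒜κ (MvPolynomial.X j)) :=
    Proj.isAffineOpen_basicOpen 𝒜κ (MvPolynomial.X j) (ProjectiveSpace.X_mem (R := κ₀) j) one_pos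
  letI := (ProjSpace.P m κ₀).presheaf.algebra_section_stalk
    (⟨(R₀).base y₀, hc⟩ : Proj.basicOpen 𝒜κ (MvPolynomial.X j))
  haveI := hU.isLocalization_stalk ⟨(R₀).base y₀, hc⟩
  set f := ((R₀).stalkMap y₀).hom with hf
  let E : MvPolynomial (Fin m) κ₀ ≃+* Γ(ProjSpace.P m κ₀, Proj.basicOpen 𝒜κ (MvPolynomial.X j)) :=
    (ProjectiveSpace.chartAlgEquiv κ₀ j).symm.toRingEquiv.trans
      (Proj.basicOpenIsoAway 𝒜κ (MvPolynomial.X j) (ProjectiveSpace.X_mem (R := κ₀) j) one_pos).commRingCatIsoToRingEquiv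
  set g := f.comp (algebraMap Γ(ProjSpace.P m κ₀, Proj.basicOpen 𝒜κ (MvPolynomial.X j))
    ((ProjSpace.P m κ₀).presheaf.stalk ((R₀).base y₀))) with hg
  set ψ := g.comp E.toRingHom with hψ
  -- the values of `ψ`
  have hval : ∀ b : Away 𝒜κ (MvPolynomial.X j),
      g ((Proj.awayToSection 𝒜κ (MvPolynomial.X j)).hom b) =
        ((affineBlowup (Ideal.span (Set.range y))).presheaf.germ (Proj.basicOpen ℛ (sElt j)) y₀ hy₀j).hom
          ((Proj.awayToSection ℛ (sElt j)).hom ((ρ j) b)) := by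
    intro b
    simp only [hg, hf, RingHom.comp_apply]
    erw [Scheme.Hom.germ_stalkMap_apply]
    rw [app_retraction₀_awayToSection]
    rfl
  have hE : ∀ q, E q = (Proj.awayToSection 𝒜κ (MvPolynomial.X j)).hom ((ProjectiveSpace.chartAlgEquiv κ₀ j).symm q) :=
    fun q => rfl
  have halg : ∀ s : S, algebraMap S ((affineBlowup (Ideal.span (Set.range y))).presheaf.stalk y₀) s =
      ((affineBlowup (Ideal.span (Set.range y))).presheaf.germ (Proj.basicOpen ℛ (sElt j)) y₀ hy₀j).hom
        ((Proj.awayToSection ℛ (sElt j)).hom (reesAwayBase y (sElt j) s)) :=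
    fun s => stalkMap_π_toStalk y κ₀ j y₀ hy₀j s
  have hψC : ∀ c, ψ (MvPolynomial.C c) =
      algebraMap S ((affineBlowup (Ideal.span (Set.range y))).presheaf.stalk y₀) (algebraMap κ₀ S c) := by
    intro c
    rw [hψ, RingHom.comp_apply, RingEquiv.toRingHom_eq_coe, RingEquiv.coe_toRingHom, hE, hval, ρ_C c, halg]
  have hψX : ∀ i, ψ (MvPolynomial.X i) * algebraMap S _ (y j) = algebraMap S _ (y (j.succAbove i)) := by
    intro i
    rw [hψ, RingHom.comp_apply, RingEquiv.toRingHom_eq_coe, RingEquiv.coe_toRingHom, hE, hval, halg, halg,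
      ← map_mul, ← map_mul, ρ_chartGen_mul i]
  obtain ⟨hflatψ, hfibψ⟩ := hDM ((affineBlowup.π (Ideal.span (Set.range y))).base y₀).asIdeal j hj _ ψ hψC hψX
  -- strip the isomorphism `E`
  have hgE : g = ψ.comp E.symm.toRingHom := by
    rw [hψ, RingHom.comp_assoc]
    ext q
    simp
  have hflatg : g.Flat := by
    rw [hgE]
    exact RingHom.Flat.comp (RingHom.Flat.of_bijective E.symm.bijective) hflatψ
  have hfibg : IsRegularLocalRing (((affineBlowup (Ideal.span (Set.range y))).presheaf.stalk y₀) ⧸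
      Ideal.map g ((maximalIdeal _).comap g)) := by
    have hid : Ideal.map ψ ((maximalIdeal _).comap ψ) =
        Ideal.map g (Ideal.map E.toRingHom (((maximalIdeal _).comap g).comap E.toRingHom)) := by
      rw [hψ, Ideal.map_map, Ideal.comap_comap]
    rw [hid, Ideal.map_comap_of_surjective E.toRingHom E.surjective] at hfibψ
    exact hfibψ
  obtain ⟨hflat, hfib⟩ := flat_and_isRegularLocalRing_fiber_of_comp
    (hU.primeIdealOf ⟨(R₀).base y₀, hc⟩).asIdeal f hflatg hfibg
  exact isParamLiftAt_of_flat_of_isRegularLocalRing_fiber R₀ y₀ hflat hfib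


end Setup

end Summit.ResolutionOfSingularities.ResolutionOfSingularities.Theorems.DepthMultiHost

end
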